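import Literature.NumberTheory.EllipticCurves.PrimaryTorsionFrobeniusUnramifiedProofs
import Literature.NumberTheory.EllipticCurves.GoodReductionUnramifiedProofs
import Literature.NumberTheory.EllipticCurves.BigGaloisRepLocalInputs
import Literature.NumberTheory.EllipticCurves.HasseWeilAbelianLSeriesProofs
import HarnessLib

/-!
# `E[p^∞]` at a place `w ∤ p` of GOOD reduction: unramified, `Frob − 1` is ONTO, and the fixed
# vectors of `Frob` and of `q_w⁻¹·Frob` are killed by `#Ẽ_w(k_w)` — PROVED

Topic `NumberTheory/EllipticCurves`; namespace `WeierstrassCurve` (as the siblings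
`PrimaryTorsionFrobeniusUnramifiedProofs`, `PrimaryTorsionLocalInvariantsGoodReductionProofs`).
THEOREMS ONLY (no definition, no named fact, no instance, no `sorry`; D-0026). Cell `bsd-stepL`
(typer lane `defn-ty1`, g9): the ARITHMETIC inputs of module L4a ("`#H¹(K_w, E[p^∞]) = #E(K_w)[p^∞]`
at a good `w ∤ p`", [GreenbergLNM1716] §2; [Castella2018] Prop. 2.5) of the discharge plan for the
named LOCAL fact `JetchevSkinnerWan2017.sigmaLocal_charIdeal_eulerFactor_mem_of_noTamagawaDefect`
(`HOME/defn-ty1/g9/NOTE-sigmaLocal-discharge-plan-defn-ty1-g9.md`). By inflation–restriction along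
`1 → I_w → Γ_{K_w} → Ẑ → 1` with `A = E[p^∞]` UNRAMIFIED (§2), `H¹(Γ_{K_w}/I_w, A) = A/(Frob − 1)A = 0`
(§3: `Frob − 1` is onto) and `H¹(K_w, A) ↪ H¹(I_w, A)^{Frob} = A(−1)^{Frob = 1} = ker(Frob − q_w | A)`,
which §3 shows is killed by `#Ẽ_w(k_w)`; the cohomological half of L4a is NOT in this file.

## What is proved

For an elliptic curve `W` over a number field `K`, a prime `p`, a finite place `w ∤ p` of good
reduction, `E[p^∞] = PrimaryTorsion (geomPoints W) p` with its `Γ_K`-action `W.primaryTorsionGaloisRep p`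
and the local groups mapped in by `BigGaloisRep.localMap K (Sum.inl w) = absGaloisRestrict K K_w`,
`localMap K (Sum.inr w)` (inertia):
* §1 `PrimaryTorsion.exists_zsmul_eq_of_divisible` — a `p`-divisible `p`-primary `ℤ_p`-module is
  `N`-divisible for every integer `N ≠ 0` (the prime-to-`p` part of `N` is a unit of `ℤ_p`);
* §2 **(unramified)** `smul_eq_of_mem_absInertia_of_hasGoodReductionAt`,
  `primaryTorsionGaloisRep_localMap_inr_apply` — `I_{K_w}` acts trivially on `E[p^∞]` (Silverman
  VII.4.1(b), the tree's DISCHARGED `smul_eq_of_mem_inertia_of_zsmul_eq_zero`, moved to `absInertia K_w`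
  by `inertia_eq_absInertia` / `resGalOfEmb_mem_inertia_primeBelow` / `resGalOfEmb_absClosureEmbedding`;
  the `Literature` twin of the Summits-side `Summit.….smul_primaryTorsion_eq_of_mem_absInertia_of_hasGoodReductionAt`);
* §3 **(Frobenius)** for ANY arithmetic Frobenius lift `φ ∈ Γ_{K_w}` (`IsFrobPow φ 1`), with
  `F = ρ(localMap K (Sum.inl w) φ)`, `q = q_w = N(w)`, `a = a_w`, `N = q − a + 1 = #Ẽ_w(k_w)`, from the
  tree's Cayley–Hamilton relation `F² = a F − q` on `E[p^∞]` (`primaryTorsionGaloisRep_sq_eq_of_isFrobPow`):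
  `primaryTorsionGaloisRep_sub_comp_eq` (`(F − 1)(F − (a − 1)) = −N`),
  **`primaryTorsionGaloisRep_sub_self_surjective_of_isFrobPow`** (`F − 1` is ONTO `E[p^∞]`),
  `natCard_point_smul_eq_zero_of_fixed` (`F y = y ⇒ N·y = 0`),
  `natCard_point_smul_eq_zero_of_smul_eq_residueCard_smul` (`F y = q·y ⇒ N·y = 0`).

HONEST FRAMING: no cohomology group is computed here; the named fact is NOT discharged by this file.

References: [SilvermanAEC2009] Prop. VII.4.1(b), C.21 Remark 21.3 (`det(X − ρ(Frob_v)) = X² − a_v X + q_v`),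
V.§1; [GreenbergLNM1716] §2 (pp. 69–71, `H¹(K_v, E[p^∞])` for `v ∤ p`); [Castella2018] Prop. 2.5 and
§2.2 ("`ℋ^ur_v` vanishes"); [NeukirchANT1999] II §9 (9.6). Tree: `PrimaryTorsionFrobeniusUnramifiedProofs`
(`primaryTorsionGaloisRep_sq_eq_of_isFrobPow`, `resGalOfEmb_absClosureEmbedding`),
`GoodReductionUnramifiedProofs` (`smul_eq_of_mem_inertia_of_zsmul_eq_zero`),
`KodairaNeronUnramifiedInertiaProofs` (`inertia_eq_absInertia`), `NeronOggShafarevichLocal`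
(`resGalOfEmb_mem_inertia_primeBelow`), `BigGaloisRepLocalInputs` (`primaryTorsion_divisible`).
-/

noncomputable section

open scoped Classical
open Field NumberField IsDedekindDomain IsDedekindDomain.HeightOneSpectrum
open Literature.NumberTheory.EllipticCurves Literature.NumberTheory.EllipticCurves.BigGaloisRep
  Literature.NumberTheory.GaloisRepresentations

universe u

/-! ## §1 `p`-divisible `p`-primary modules are `N`-divisible for every `N ≠ 0` -/

namespace Literature.NumberTheory.EllipticCurves.PrimaryTorsion

variable {A : Type u} [AddCommGroup A] {p : ℕ} [Fact p.Prime]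

/-- An integer prime to `p` acts bijectively on a `p`-primary module: it is a unit of `ℤ_p`.
[cite: Lang1990, Ch. 5 §1 (the action of ℤ_p on p-power torsion)] -/
theorem exists_zsmul_eq_of_not_dvd {m : ℤ} (hm : ¬ (p : ℤ) ∣ m) (a : PrimaryTorsion A p) :
    ∃ b : PrimaryTorsion A p, m • b = a := by
  have hu : IsUnit ((m : ℤ) : ℤ_[p]) := by
    rw [PadicInt.isUnit_iff]
    exact le_antisymm (PadicInt.norm_le_one _)
      (not_lt.1 fun h ↦ hm ((PadicInt.norm_int_lt_one_iff_dvd m).1 h))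
  obtain ⟨u, hu⟩ := hu
  refine ⟨((u⁻¹ : ℤ_[p]ˣ) : ℤ_[p]) • a, ?_⟩
  rw [← Int.cast_smul_eq_zsmul ℤ_[p], ← hu, smul_smul, Units.mul_inv, one_smul]

/-- **A `p`-divisible `p`-primary module is `N`-divisible for every integer `N ≠ 0`**: write
`N = ± p^e · m` with `p ∤ m`; `m` is invertible on the module and `p^e` is onto by hypothesis.
[cite: Lang1990, Ch. 5 §1] -/
theorem exists_zsmul_eq_of_divisible (hdiv : ∀ a : PrimaryTorsion A p, ∃ b : PrimaryTorsion A p, p • b = a)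
    {N : ℤ} (hN : N ≠ 0) (a : PrimaryTorsion A p) : ∃ b : PrimaryTorsion A p, N • b = a := by
  have hp : (p : ℕ) ≠ 1 := (Fact.out : p.Prime).ne_one
  obtain ⟨e, m, hm, hNem⟩ := Nat.exists_eq_pow_mul_and_not_dvd (Int.natAbs_ne_zero.2 hN) p hp
  -- `p^e` is onto
  have hpow : ∀ (k : ℕ) (a : PrimaryTorsion A p), ∃ b : PrimaryTorsion A p, (p ^ k : ℕ) • b = a := by
    intro k
    induction k with
    | zero => intro a; exact ⟨a, by rw [pow_zero, one_smul]⟩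
    | succ k ih =>
      intro a
      obtain ⟨b, hb⟩ := ih a
      obtain ⟨c, hc⟩ := hdiv b
      exact ⟨c, by rw [pow_succ, mul_smul, hc, hb]⟩
  -- `± m` is invertible
  have hm' : ¬ (p : ℤ) ∣ (N.sign * m : ℤ) := fun h ↦ hm (by
    rwa [Int.natCast_dvd, Int.natAbs_mul, Int.natAbs_sign_of_ne_zero hN, one_mul,
      Int.natAbs_natCast] at h)
  obtain ⟨b₁, hb₁⟩ := exists_zsmul_eq_of_not_dvd (A := A) hm' a
  obtain ⟨b₂, hb₂⟩ := hpow e b₁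
  refine ⟨b₂, ?_⟩
  have hN' : N = (N.sign * m : ℤ) * ((p ^ e : ℕ) : ℤ) := by
    conv_lhs => rw [← Int.sign_mul_natAbs N, hNem]
    push_cast
    ring
  rw [hN', mul_smul, natCast_zsmul, hb₂, hb₁]

end Literature.NumberTheory.EllipticCurves.PrimaryTorsion

namespace IsDedekindDomain.HeightOneSpectrum

/-- **`p ∤ N(w)` for a finite place `w ∤ p`**: if `p ∣ #(𝓞_K/w)` then (Cauchy) the residue field has an
element of additive order `p`, so `p = 0` in the field `𝓞_K/w`, i.e. `p ∈ w` (`N(𝔭) = p^f` with `p` the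
prime UNDER `𝔭`). [cite: NeukirchANT1999, Ch. I §8 (the residue class degree: 𝔑(𝔭) = p^{f}, p the prime below 𝔭)] -/
theorem not_dvd_absNorm_of_notMem {K : Type*} [Field K] [NumberField K] {w : HeightOneSpectrum (𝓞 K)}
    {p : ℕ} [hp : Fact p.Prime] (hpw : ((p : ℕ) : 𝓞 K) ∉ w.asIdeal) : ¬ p ∣ Ideal.absNorm w.asIdeal := by
  intro h
  rw [Ideal.absNorm_apply, Submodule.cardQuot_apply] at h
  letI := Ideal.Quotient.field w.asIdeal
  obtain ⟨x, hx⟩ := exists_prime_addOrderOf_dvd_card' (G := 𝓞 K ⧸ w.asIdeal) p h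
  have hx0 : x ≠ 0 := by
    intro h0
    rw [h0, addOrderOf_zero] at hx
    exact hp.out.one_lt.ne' hx.symm
  have hpx : (p : 𝓞 K ⧸ w.asIdeal) * x = 0 := by
    rw [← nsmul_eq_mul, ← hx, addOrderOf_nsmul_eq_zero]
  have hp0 : (p : 𝓞 K ⧸ w.asIdeal) = 0 := (mul_eq_zero.1 hpx).resolve_right hx0
  apply hpw
  rw [← Ideal.Quotient.eq_zero_iff_mem, map_natCast]
  exact hp0

end IsDedekindDomain.HeightOneSpectrum

namespace WeierstrassCurve

variable {K : Type u} [Field K] [NumberField K] (W : WeierstrassCurve K) [W.IsElliptic]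
  (p : ℕ) [Fact p.Prime] {w : HeightOneSpectrum (𝓞 K)}

/-! ## §2 `E[p^∞]` is unramified at a good place `w ∤ p` (VII.4.1(b), `localMap` currency) -/

omit [Fact p.Prime] in
/-- **Silverman VII.4.1(b) in `localMap` currency, on points.** At a finite place `w` of good reduction
and for `n` prime to `w`, every `σ` of the local inertia group `I_{K_w} = absInertia K_w ⊂ Γ_{K_w}`,
restricted to `Γ_K` along the chosen embedding (`absGaloisRestrict K K_w = localMap K (Sum.inl w)`),
fixes every `P ∈ E(K̄)` with `n P = O`. (Literature twin of the Summits-side statement of the same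
name in `ErratumRoadFiveBigRepArithInputs`.)
[cite: SilvermanAEC2009, Prop. VII.4.1(b)] [cite: NeukirchANT1999, Ch. II §9 Prop. (9.6)] -/
theorem smul_eq_of_mem_absInertia_of_hasGoodReductionAt (hv : W.HasGoodReductionAt w) {n : ℤ}
    (hn : (n : 𝓞 K) ∉ w.asIdeal) {σ : absoluteGaloisGroup (w.adicCompletion K)}
    (hσ : σ ∈ absInertia (w.adicCompletion K)) {P : W.geomPoints} (hP : n • P = 0) :
    absGaloisRestrict K (w.adicCompletion K) σ • P = P := by
  obtain ⟨𝔐, h𝔐⟩ := w.localPrimesAbove_nonempty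
  obtain ⟨val, hval⟩ := w.exists_spectralValuation
  have hσ' : σ ∈ 𝔐.inertia (absoluteGaloisGroup (w.adicCompletion K)) := by
    rw [HeightOneSpectrum.inertia_eq_absInertia hval h𝔐]
    exact hσ
  have hmem := w.resGalOfEmb_mem_inertia_primeBelow (absClosureEmbedding K (w.adicCompletion K)) 𝔐 hσ'
  rw [resGalOfEmb_absClosureEmbedding] at hmem
  exact W.smul_eq_of_mem_inertia_of_zsmul_eq_zero hv hn
    (HeightOneSpectrum.primeBelow_mem_primesAbove h𝔐) hmem hP

/-- **`E[p^∞]` is UNRAMIFIED at a good place `w ∤ p`**: the local inertia group, mapped into `Γ_K` by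
`localMap K (Sum.inr w)`, acts trivially on `E[p^∞]` through `W.primaryTorsionGaloisRep p` — the
hypothesis `hram` ∕ "(unr)" of the tree's `Σ`-Selmer comparison files, DISCHARGED at the good places.
[cite: SilvermanAEC2009, Prop. VII.4.1(b)] [cite: Castella2018, §2.2 (ℋ^ur_w at w ∤ p where T is unramified)] -/
theorem primaryTorsionGaloisRep_localMap_inr_apply (hv : W.HasGoodReductionAt w)
    (hpw : ((p : ℕ) : 𝓞 K) ∉ w.asIdeal) (σ : LocalGroup K (Sum.inr w))
    (P : PrimaryTorsion (geomPoints W) p) :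
    W.primaryTorsionGaloisRep p (localMap K (Sum.inr w) σ) P = P := by
  obtain ⟨k, hk⟩ := P.exists_pow_smul_eq_zero
  refine PrimaryTorsion.ext ?_
  rw [val_primaryTorsionGaloisRep_apply]
  have hn : (((p : ℤ) ^ k : ℤ) : 𝓞 K) ∉ w.asIdeal := by
    rw [Int.cast_pow, Int.cast_natCast]
    exact fun h ↦ hpw (w.isPrime.mem_of_pow_mem k h)
  have hP : ((p : ℤ) ^ k) • (P : geomPoints W) = 0 := by
    rw [← Int.natCast_pow, natCast_zsmul]
    exact hk
  exact W.smul_eq_of_mem_absInertia_of_hasGoodReductionAt hv hn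
    (σ := (show ↥(absInertia (w.adicCompletion K)) from σ).1)
    (show ↥(absInertia (w.adicCompletion K)) from σ).2 hP

/-! ## §3 A Frobenius lift on `E[p^∞]` at a good place `w ∤ p`: `F − 1` onto, fixed vectors killed by `#Ẽ_w(k_w)` -/

section Frobenius

variable {φ : absoluteGaloisGroup (w.adicCompletion K)}

/-- **`(F − 1) ∘ (F − (a_w − 1)) = −#Ẽ_w(k_w)` on `E[p^∞]`** for `F = ρ(res φ)`, `φ ∈ Γ_{K_w}` an
arithmetic Frobenius lift at a good `w ∤ p`: expand and use Cayley–Hamilton `F² = a_w F − q_w`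
(`primaryTorsionGaloisRep_sq_eq_of_isFrobPow`); `q_w − a_w + 1 = #Ẽ_w(k_w)`.
[cite: SilvermanAEC2009, C.21 Remark 21.3 (det(X − ρ(Frob)) = X² − a X + q) and C.§16] -/
theorem primaryTorsionGaloisRep_sub_comp_eq (hpw : ((p : ℕ) : 𝓞 K) ∉ w.asIdeal)
    (hv : W.HasGoodReductionAt w) (hφ : IsFrobPow φ 1) (y : PrimaryTorsion (geomPoints W) p) :
    W.primaryTorsionGaloisRep p (localMap K (Sum.inl w) φ)
        (W.primaryTorsionGaloisRep p (localMap K (Sum.inl w) φ) y - (W.frobeniusTraceAt w - 1) • y) -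
      (W.primaryTorsionGaloisRep p (localMap K (Sum.inl w) φ) y - (W.frobeniusTraceAt w - 1) • y) =
      -((Nat.card (W.reductionAt w).toAffine.Point : ℤ) • y) := by
  have hCH := W.primaryTorsionGaloisRep_sq_eq_of_isFrobPow hpw hv hφ y
  change W.primaryTorsionGaloisRep p (absGaloisRestrict K (w.adicCompletion K) φ)
      (W.primaryTorsionGaloisRep p (absGaloisRestrict K (w.adicCompletion K) φ) y -
        (W.frobeniusTraceAt w - 1) • y) -
      (W.primaryTorsionGaloisRep p (absGaloisRestrict K (w.adicCompletion K) φ) y -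
        (W.frobeniusTraceAt w - 1) • y) = _
  set F := W.primaryTorsionGaloisRep p (absGaloisRestrict K (w.adicCompletion K) φ) with hF
  have hcard : (Nat.card (W.reductionAt w).toAffine.Point : ℤ) =
      (Nat.card (IsLocalRing.ResidueField (w.adicCompletionIntegers K)) : ℤ) - W.frobeniusTraceAt w + 1 := by
    rw [frobeniusTraceAt_def]; ring
  rw [map_sub, map_zsmul, hCH, hcard]
  module

/-- **`F − 1` is ONTO `E[p^∞]`** for `F = ρ(res φ)`, `φ ∈ Γ_{K_w}` any arithmetic Frobenius lift at a
good place `w ∤ p` (so `H¹(Γ_{K_w}/I_w, E[p^∞]) = E[p^∞]/(F − 1) = 0`): by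
`primaryTorsionGaloisRep_sub_comp_eq`, `(F − 1)` composed with `F − (a_w − 1)` is multiplication by
`−#Ẽ_w(k_w) ≠ 0`, which is onto the divisible group `E[p^∞]` (`primaryTorsion_divisible`,
`PrimaryTorsion.exists_zsmul_eq_of_divisible`).
[cite: GreenbergLNM1716, §2 (p. 70, H¹(K_v^{unr}/K_v, E[p^∞]) for v ∤ p)] [cite: Castella2018, §2.2 ("ℋ^ur_v vanishes")] -/
theorem primaryTorsionGaloisRep_sub_self_surjective_of_isFrobPow (hpw : ((p : ℕ) : 𝓞 K) ∉ w.asIdeal)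
    (hv : W.HasGoodReductionAt w) (hφ : IsFrobPow φ 1) :
    Function.Surjective fun y : PrimaryTorsion (geomPoints W) p ↦
      W.primaryTorsionGaloisRep p (localMap K (Sum.inl w) φ) y - y := by
  intro Q
  have hN : (-(Nat.card (W.reductionAt w).toAffine.Point : ℤ)) ≠ 0 := by
    haveI : Finite (IsLocalRing.ResidueField (w.adicCompletionIntegers K)) :=
      finite_residueField_adicCompletionIntegers K w
    haveI := finite_point (W.reductionAt w)
    haveI : Nonempty (W.reductionAt w).toAffine.Point := ⟨.zero⟩
    have h : 0 < Nat.card (W.reductionAt w).toAffine.Point := Nat.card_pos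
    rw [neg_ne_zero]
    exact_mod_cast h.ne'
  obtain ⟨y, hy⟩ := PrimaryTorsion.exists_zsmul_eq_of_divisible
    (fun a ↦ W.primaryTorsion_divisible p a ((a.exists_pow_smul_eq_zero).imp fun k hk ↦
      PrimaryTorsion.ext (by rw [PrimaryTorsion.val_nsmul, hk, PrimaryTorsion.val_zero]))) hN Q
  refine ⟨W.primaryTorsionGaloisRep p (localMap K (Sum.inl w) φ) y - (W.frobeniusTraceAt w - 1) • y, ?_⟩
  change _ - _ = Q
  rw [W.primaryTorsionGaloisRep_sub_comp_eq p hpw hv hφ y, ← hy, neg_zsmul]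

/-- **A vector fixed by a Frobenius lift is killed by `#Ẽ_w(k_w)`**: `F y = y ⇒ (q_w − a_w + 1)·y = 0`
(Cayley–Hamilton at the eigenvalue `1`). Together with the tree's
`natCard_primaryTorsion_invariants_dvd` this is the crude form of `#E(K_w)[p^∞] ∣ #Ẽ_w(k_w)`.
[cite: SilvermanAEC2009, C.21 Remark 21.3 and Prop. VII.3.1(b)] -/
theorem natCard_point_smul_eq_zero_of_fixed (hpw : ((p : ℕ) : 𝓞 K) ∉ w.asIdeal)
    (hv : W.HasGoodReductionAt w) (hφ : IsFrobPow φ 1) {y : PrimaryTorsion (geomPoints W) p}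
    (hy : W.primaryTorsionGaloisRep p (localMap K (Sum.inl w) φ) y = y) :
    (Nat.card (W.reductionAt w).toAffine.Point : ℤ) • y = 0 := by
  have h := W.primaryTorsionGaloisRep_sub_comp_eq p hpw hv hφ y
  rw [map_sub, map_zsmul, hy, hy, sub_self] at h
  exact neg_eq_zero.1 h.symm

/-- **A vector on which a Frobenius lift acts by `q_w` is killed by `#Ẽ_w(k_w)`**:
`F y = q_w·y ⇒ q_w (q_w − a_w + 1)·y = 0` (Cayley–Hamilton at the eigenvalue `q_w`), and `q_w` is prime
to `p` — the bound on `A(−1)^{Frob = 1} = H¹(I_w, E[p^∞])^{Frob}` in the inflation–restriction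
computation of `H¹(K_w, E[p^∞])`.
[cite: SilvermanAEC2009, C.21 Remark 21.3] [cite: GreenbergLNM1716, §2 (p. 71)] -/
theorem natCard_point_smul_eq_zero_of_smul_eq_residueCard_smul (hpw : ((p : ℕ) : 𝓞 K) ∉ w.asIdeal)
    (hv : W.HasGoodReductionAt w) (hφ : IsFrobPow φ 1) {y : PrimaryTorsion (geomPoints W) p}
    (hy : W.primaryTorsionGaloisRep p (localMap K (Sum.inl w) φ) y =
      (Nat.card (IsLocalRing.ResidueField (w.adicCompletionIntegers K)) : ℤ) • y) :
    (Nat.card (W.reductionAt w).toAffine.Point : ℤ) • y = 0 := by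
  set q : ℤ := (Nat.card (IsLocalRing.ResidueField (w.adicCompletionIntegers K)) : ℤ) with hq
  have hCH := W.primaryTorsionGaloisRep_sq_eq_of_isFrobPow hpw hv hφ y
  change W.primaryTorsionGaloisRep p (localMap K (Sum.inl w) φ)
      (W.primaryTorsionGaloisRep p (localMap K (Sum.inl w) φ) y) =
    W.frobeniusTraceAt w • W.primaryTorsionGaloisRep p (localMap K (Sum.inl w) φ) y - q • y at hCH
  rw [hy, map_zsmul, hy] at hCH
  -- `hCH : q • q • y = a • q • y - q • y`, i.e. `(q * N) • y = 0`
  have hcard : (Nat.card (W.reductionAt w).toAffine.Point : ℤ) = q - W.frobeniusTraceAt w + 1 := by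
    rw [hq, frobeniusTraceAt_def]; ring
  have hqN : (q * (Nat.card (W.reductionAt w).toAffine.Point : ℤ)) • y = 0 := by
    rw [hcard]
    have : (q * (q - W.frobeniusTraceAt w + 1)) • y = q • q • y - W.frobeniusTraceAt w • q • y + q • y := by
      module
    rw [this, hCH]
    module
  -- `q = N(w)` is prime to `p`: cancel it
  have hqp : ¬ (p : ℤ) ∣ q := by
    rw [hq, natCard_residueField_adicCompletionIntegers_eq_absNorm, Int.natCast_dvd_natCast]
    exact not_dvd_absNorm_of_notMem hpw
  have hu : IsUnit ((q : ℤ) : ℤ_[p]) := by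
    rw [PadicInt.isUnit_iff]
    exact le_antisymm (PadicInt.norm_le_one _)
      (not_lt.1 fun h ↦ hqp ((PadicInt.norm_int_lt_one_iff_dvd q).1 h))
  obtain ⟨u, hu⟩ := hu
  have h1 : ((u : ℤ_[p]) : ℤ_[p]) • ((Nat.card (W.reductionAt w).toAffine.Point : ℤ) • y) = 0 := by
    rw [hu, Int.cast_smul_eq_zsmul, ← mul_smul, hqN]
  have h2 := congrArg (fun t ↦ ((u⁻¹ : ℤ_[p]ˣ) : ℤ_[p]) • t) h1
  simp only [smul_smul, Units.inv_mul, one_smul, smul_zero] at h2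
  exact h2

end Frobenius

end WeierstrassCurve

end
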